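import Summits.RiemannHypothesis.RiemannHypothesis.Theorems.WeilFormatCTailEvenJMatrix
import Summits.RiemannHypothesis.RiemannHypothesis.Theorems.WeilFormatCTailOddJMatrix
import Summits.RiemannHypothesis.RiemannHypothesis.Theorems.WeilFormatCFarDiagPos
import Summits.RiemannHypothesis.RiemannHypothesis.Theorems.WeilFormatCSectorKernels
import Summits.RiemannHypothesis.RiemannHypothesis.Theorems.WeilFormatCEntrySesq
import Summits.RiemannHypothesis.RiemannHypothesis.Theorems.WeilFormatCCertificate
import Summits.RiemannHypothesis.RiemannHypothesis.Theorems.WeilFormatCDataRung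
import HarnessLib

/-!
# Format C: the DATA-ONLY front door at tail order `J` — two kernel PSD checks + numeric inequalities ⟹ `WeilPositivityOn a`

Route context: Fourier–Galerkin / Schur-complement certificates of Weil positivity on a window ("format C";
cell memo `run/shared/lean/pub/rh-explicit/rh-explicit-weil-10/FORMATC-DESIGN.md` §9; supporting
stmt-RiemannHypothesis-0098; seat rh-explicit-weil-10).  Composition of the whole format-C Lean chain (weil-2: entries
`weilWindowSesq_chi` = Yoshida (5.15)/(5.16), `gramCoeff_neg_neg`, SectorSplit; weil-3: the dictionary; weil-10: ∀N
soundness, L-C3a `gramCoeff_even/odd_far_ge_diag[_atan]`, far-diagonal positivity, L-C3b order 1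
`even/odd_tailJ_majorant_matrix`, this gen's order-`J` Hankel tails) into ONE theorem whose hypotheses are exactly what a rung's data files establish by
kernel arithmetic (`M⁺ = [i=0: G(0,m) | (G(i,m)+G(i,−m))/2]`, `M⁻(k,l) = (G(k+1,l+1) − G(k+1,−(l+1)))/2`,
`G = gramCoeff a`, `d̂⁺`, `d̂⁻` the closed-form far diagonals of `WeilFormatCFarAssembly.lean` (odd: arctan weights)):

* `weilPositivityOn_of_formatC_dataJ` — `a > 0`; EVEN: block `B⁺ ≥ 2`, column range `2B⁺ ≤ B₃⁺`, `θ⁺ > 0`, the numeric facts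
  `0 < d̂⁺(B⁺)` and `0 < d₀⁺ ≤ d̂⁺(B₃⁺)`, column weights `0 < w⁺_m ≤ d̂⁺(m)` on `B⁺ ≤ m < B₃⁺`, and the kernel certificate
  `∀ x, 0 ≤ Σ_{i,j<B⁺} x_i x_j (M⁺(i,j) − Σ_{m∈Ico B⁺ B₃⁺} M⁺(i,m)M⁺(j,m)/w⁺_m − U₂⁺(i,j))` with the explicit ORDER-`J` tail
  matrix `U₂⁺` of `even_tailJ_majorant_matrix` (`J = Je`, Peter–Paul parameters `θe, ηe > 0`); ODD: the same with `B⁻ ≥ 1`, `d̂⁻`, `U₂⁻`, and the positivity facts stated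
  for the monotone core minus `π/4`.  Conclusion: `WeilPositivityOn a`.

No analytic hypothesis is left: every remaining premise is a finite inequality between explicit real constants
(`reDigammaQuarter` at finitely many points, `weilArchDensity (2a)`, `Λ`, `exp`, `log π`, `√`, `arctan`) or the PSD check,
all in the scope of weil-2's evaluator + `PsdDyadic.checkPsdMid`.  Compared with the order-1 door `weilPositivityOn_of_formatC_data`
the exact-column range `[B, B₃)` can stop at `B₃ = 2B` (the remainder decays like `4^{−J}`).  Standard axioms; no definitions;
no RH claim (a rung `WeilPositivityOn a` is one case of `riemannHypothesis_iff_forall_weilPositivityOn`).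
-/

set_option autoImplicit false
-- `Summit.RiemannHypothesis.RiemannHypothesis.…` is the layout-mandated namespace (summit = problem name).
set_option linter.dupNamespace false

noncomputable section

open Complex Finset Matrix
open scoped Real BigOperators ArithmeticFunction.vonMangoldt

namespace Summit.RiemannHypothesis.RiemannHypothesis.Theorems.WeilFormatC

open Literature.NumberTheory.LFunctions Literature.NumberTheory.LFunctions.Yoshida1992
open Literature.Analysis.SpecialFunctions

variable {a : ℝ}

/-! ## The data-only rung theorem -/

section Rung

/-- **Format C, data-only front door.**  See the module docstring: every hypothesis is a finite numeric inequality or a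
kernel PSD statement about explicit real matrices built from `gramCoeff a`; the conclusion is the rung
`WeilPositivityOn a`.  (Even block: modes `0..B⁺−1`, exact columns `B⁺ ≤ m < B₃⁺`, order-1 tail beyond; odd block: kernel
indices `0..B⁻−1` = modes `1..B⁻`, exact columns `B⁻ ≤ l < B₃⁻`.) -/
theorem weilPositivityOn_of_formatC_dataJ (ha : 0 < a)
    -- EVEN sector data
    {Be B3e : ℕ} (hBe : 2 ≤ Be) (hBBe : 2 * Be ≤ B3e) (Je : ℕ) {θe ηe d0e : ℝ} (hθe : 0 < θe) (hηe : 0 < ηe)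
    (we : ℕ → ℝ)
    (h0e : 0 < ((reDigammaQuarter (freq a Be) - Real.log π) / 2 - a * (1 + weilArchDensity (2 * a)) / (π ^ 2 * Be ^ 2) - 1 / (8 * Be) - a * (1 + weilArchDensity (2 * a)) / π ^ 2 * Real.sqrt (8 / ((Be - 1 : ℕ) : ℝ)) - (∑ k ∈ weilPrimeIndex a, (Λ k : ℝ) / Real.sqrt k * (2 * Real.cos (π / (⌊2 * a / Real.log k⌋₊ + 2)))) / 2))
    (hd0e : 0 < d0e ∧ d0e ≤ ((reDigammaQuarter (freq a B3e) - Real.log π) / 2 - a * (1 + weilArchDensity (2 * a)) / (π ^ 2 * B3e ^ 2) - 1 / (8 * B3e) - a * (1 + weilArchDensity (2 * a)) / π ^ 2 * Real.sqrt (8 / ((Be - 1 : ℕ) : ℝ)) - (∑ k ∈ weilPrimeIndex a, (Λ k : ℝ) / Real.sqrt k * (2 * Real.cos (π / (⌊2 * a / Real.log k⌋₊ + 2)))) / 2))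
    (hwe : ∀ m, Be ≤ m → m < B3e → 0 < we m ∧ we m ≤ ((reDigammaQuarter (freq a m) - Real.log π) / 2 - a * (1 + weilArchDensity (2 * a)) / (π ^ 2 * m ^ 2) - 1 / (8 * m) - a * (1 + weilArchDensity (2 * a)) / π ^ 2 * Real.sqrt (8 / ((Be - 1 : ℕ) : ℝ)) - (∑ k ∈ weilPrimeIndex a, (Λ k : ℝ) / Real.sqrt k * (2 * Real.cos (π / (⌊2 * a / Real.log k⌋₊ + 2)))) / 2))
    (hSe : ∀ x : Fin Be → ℝ, 0 ≤ ∑ i, ∑ i', x i * x i' *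
      ((if (i : ℕ) = 0 then gramCoeff a 0 i' else if (i' : ℕ) = 0 then gramCoeff a i 0 else (gramCoeff a i i' + gramCoeff a i (-(i' : ℤ))) / 2)
        - (∑ m ∈ Finset.Ico Be B3e, (if (i : ℕ) = 0 then gramCoeff a 0 m else if m = 0 then gramCoeff a i 0 else (gramCoeff a i m + gramCoeff a i (-(m : ℤ))) / 2) * (if (i' : ℕ) = 0 then gramCoeff a 0 m else if m = 0 then gramCoeff a i' 0 else (gramCoeff a i' m + gramCoeff a i' (-(m : ℤ))) / 2) / we m)
        - ((1 + θe) * (1 + ηe) * ((π / 4 + (∑ k ∈ weilPrimeIndex a, (Λ k : ℝ) / Real.sqrt k) + a * (1 + weilArchDensity (2 * a)) / (π * B3e)) ^ 2 / (π ^ 2 * d0e))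
            * (∑ j : Fin Je, ∑ j' : Fin Je, (((1 / (((2 * (j : ℕ) + 1) + (2 * (j' : ℕ) + 1) - 1 : ℕ) * (((B3e - 1 : ℕ) : ℝ)) ^ ((2 * (j : ℕ) + 1) + (2 * (j' : ℕ) + 1) - 1)) + 1 / (((2 * (j : ℕ) + 1) + (2 * (j' : ℕ) + 1) - 1 : ℕ) * (B3e : ℝ) ^ ((2 * (j : ℕ) + 1) + (2 * (j' : ℕ) + 1) - 1))) / 2) + (if j = j' then (∑ j' : Fin Je, ((1 / (((2 * (j : ℕ) + 1) + (2 * (j' : ℕ) + 1) - 1 : ℕ) * (((B3e - 1 : ℕ) : ℝ)) ^ ((2 * (j : ℕ) + 1) + (2 * (j' : ℕ) + 1) - 1)) - 1 / (((2 * (j : ℕ) + 1) + (2 * (j' : ℕ) + 1) - 1 : ℕ) * (B3e : ℝ) ^ ((2 * (j : ℕ) + 1) + (2 * (j' : ℕ) + 1) - 1))) / 2) * (Be : ℝ) ^ (2 * (j' : ℕ) + 1) / (Be : ℝ) ^ (2 * (j : ℕ) + 1)) else 0)) * ((-1 : ℝ) ^ (i : ℕ) * (i : ℝ) ^ (2 *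 (j : ℕ))) * ((-1 : ℝ) ^ (i' : ℕ) * (i' : ℝ) ^ (2 * (j' : ℕ))))
          + (1 + θe) * (1 + ηe⁻¹) * (1 / d0e)
            * (∑ r : Fin Je, ∑ r' : Fin Je, (((1 / (((2 * (r : ℕ) + 2) + (2 * (r' : ℕ) + 2) - 1 : ℕ) * (((B3e - 1 : ℕ) : ℝ)) ^ ((2 * (r : ℕ) + 2) + (2 * (r' : ℕ) + 2) - 1)) + 1 / (((2 * (r : ℕ) + 2) + (2 * (r' : ℕ) + 2) - 1 : ℕ) * (B3e : ℝ) ^ ((2 * (r : ℕ) + 2) + (2 * (r' : ℕ) + 2) - 1))) / 2) + (if r = r' then (∑ r' : Fin Je, ((1 / (((2 * (r : ℕ) + 2) + (2 * (r' : ℕ) + 2) - 1 : ℕ) * (((B3e - 1 : ℕ) : ℝ)) ^ ((2 * (r : ℕ) + 2) + (2 * (r' : ℕ) + 2) - 1)) - 1 / (((2 * (r : ℕ) + 2) + (2 * (r' : ℕ) + 2) - 1 : ℕ) * (B3e : ℝ) ^ ((2 * (r : ℕ) + 2) + (2 * (r' : ℕ) + 2) - 1))) / 2) * (Be : ℝ)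 ^ (2 * (r' : ℕ) + 2) / (Be : ℝ) ^ (2 * (r : ℕ) + 2)) else 0)) * ((-1 : ℝ) ^ (i : ℕ) * (-((i : ℝ) ^ (2 * (r : ℕ) + 1)) * ((Complex.digamma (1 / 4 + ((freq a i : ℝ) : ℂ) / 2 * I)).im / 2 + (∑ k ∈ weilPrimeIndex a, (Λ k : ℝ) / Real.sqrt k * Real.sin (freq a i * Real.log k)) - archExpSumSin a i) / π + 4 / a * (Real.exp (a / 2) - Real.exp (-(a / 2))) ^ 2 * (-1 : ℝ) ^ (r : ℕ) * (a ^ 2 / (4 * π ^ 2)) ^ ((r : ℕ) + 1) * (1 / (1 + 4 * freq a i ^ 2)))) * ((-1 : ℝ) ^ (i' : ℕ) * (-((i' : ℝ) ^ (2 * (r' : ℕ) + 1)) * ((Complex.digamma (1 / 4 + ((freq a i' : ℝ) : ℂ) / 2 * I)).im / 2 + (∑ k ∈ weilPrimeIndex a, (Λ k : ℝ) / Real.sqrt k * Real.sin (freq a i' * Real.log k)) - archExpSumSin a i') / π + 4 / a * (Real.exp (a / 2) - Real.exp (-(a / 2))) ^ 2 * (-1 : ℝ) ^ (r' : ℕ)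 * (a ^ 2 / (4 * π ^ 2)) ^ ((r' : ℕ) + 1) * (1 / (1 + 4 * freq a i' ^ 2)))))
          + (if i = i' then (1 + θe⁻¹) * ((Be : ℝ) / (d0e * ((4 * Je + 1 : ℕ) * (((B3e - 1 : ℕ) : ℝ)) ^ (4 * Je + 1)))) * (2 * (π / 4 + (∑ k ∈ weilPrimeIndex a, (Λ k : ℝ) / Real.sqrt k) + a * (1 + weilArchDensity (2 * a)) / π) * (i : ℝ) ^ (2 * Je) / π + 4 / a * (Real.exp (a / 2) - Real.exp (-(a / 2))) ^ 2 * (a ^ 2 / (4 * π ^ 2)) ^ (Je + 1) * (1 / (1 + 4 * freq a i ^ 2))) ^ 2 else 0))))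
    -- ODD sector data
    {Bo B3o : ℕ} (hBo : 1 ≤ Bo) (hBBo : 2 * Bo ≤ B3o) (Jo : ℕ) {θo ηo d0o : ℝ} (hθo : 0 < θo) (hηo : 0 < ηo)
    (wo : ℕ → ℝ)
    (h0o : 0 < ((reDigammaQuarter (freq a ((Bo : ℤ) + 1)) - Real.log π) / 2 - 1 / (8 * ((Bo : ℝ) + 1)) - a * (1 + weilArchDensity (2 * a)) / (π ^ 2 * ((Bo : ℝ) + 1) ^ 2)) - π / 4 - a * (1 + weilArchDensity (2 * a)) / π ^ 2 * Real.sqrt (8 / Bo) - (∑ k ∈ weilPrimeIndex a, (Λ k : ℝ) / Real.sqrt k * (2 * Real.cos (π / (⌊2 * a / Real.log k⌋₊ + 2)))) / 2 - (Real.exp (a / 2) - Real.exp (-(a / 2))) ^ 2 * a / (π ^ 2 * Bo))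
    (hd0o : 0 < d0o ∧ d0o ≤ ((reDigammaQuarter (freq a ((B3o : ℤ) + 1)) - Real.log π) / 2 - 1 / (8 * ((B3o : ℝ) + 1)) - a * (1 + weilArchDensity (2 * a)) / (π ^ 2 * ((B3o : ℝ) + 1) ^ 2)) - π / 4 - a * (1 + weilArchDensity (2 * a)) / π ^ 2 * Real.sqrt (8 / Bo) - (∑ k ∈ weilPrimeIndex a, (Λ k : ℝ) / Real.sqrt k * (2 * Real.cos (π / (⌊2 * a / Real.log k⌋₊ + 2)))) / 2 - (Real.exp (a / 2) - Real.exp (-(a / 2))) ^ 2 * a / (π ^ 2 * Bo))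
    (hwo : ∀ l, Bo ≤ l → l < B3o → 0 < wo l ∧ wo l ≤ ((reDigammaQuarter (freq a ((l : ℤ) + 1)) - Real.log π) / 2 - 1 / (8 * ((l : ℝ) + 1)) - a * (1 + weilArchDensity (2 * a)) / (π ^ 2 * ((l : ℝ) + 1) ^ 2) - (π / 2 - Real.arctan (Real.sqrt Bo / Real.sqrt ((l : ℝ) + 1))) / 2 - a * (1 + weilArchDensity (2 * a)) / π ^ 2 * Real.sqrt (8 / Bo) - (∑ k ∈ weilPrimeIndex a, (Λ k : ℝ) / Real.sqrt k * (2 * Real.cos (π / (⌊2 * a / Real.log k⌋₊ + 2)))) / 2 - (Real.exp (a / 2) - Real.exp (-(a / 2))) ^ 2 * a / (π ^ 2 * Bo)))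
    (hSo : ∀ x : Fin Bo → ℝ, 0 ≤ ∑ k, ∑ k', x k * x k' *
      (((gramCoeff a (((k : ℕ) : ℤ) + 1) (((k' : ℕ) : ℤ) + 1) - gramCoeff a (((k : ℕ) : ℤ) + 1) (-(((k' : ℕ) : ℤ) + 1))) / 2)
        - (∑ l ∈ Finset.Ico Bo B3o, ((gramCoeff a (((k : ℕ) : ℤ) + 1) ((l : ℤ) + 1) - gramCoeff a (((k : ℕ) : ℤ) + 1) (-((l : ℤ) + 1))) / 2) * ((gramCoeff a (((k' : ℕ) : ℤ) + 1) ((l : ℤ) + 1) - gramCoeff a (((k' : ℕ) : ℤ) + 1) (-((l : ℤ) + 1))) / 2) / wo l)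
        - ((1 + θo) * (1 + ηo) * ((π / 4 + (∑ k ∈ weilPrimeIndex a, (Λ k : ℝ) / Real.sqrt k) + a * (1 + weilArchDensity (2 * a)) / (π * ((B3o : ℝ) + 1))) ^ 2 / (π ^ 2 * d0o))
            * (∑ j : Fin Jo, ∑ j' : Fin Jo, (((1 / (((2 * (j : ℕ) + 2) + (2 * (j' : ℕ) + 2) - 1 : ℕ) * (B3o : ℝ) ^ ((2 * (j : ℕ) + 2) + (2 * (j' : ℕ) + 2) - 1)) + 1 / (((2 * (j : ℕ) + 2) + (2 * (j' : ℕ) + 2) - 1 : ℕ) * ((B3o + 1 : ℕ) : ℝ) ^ ((2 * (j : ℕ) + 2) + (2 * (j' : ℕ) + 2) - 1))) / 2) + (if j = j' then (∑ j' : Fin Jo, ((1 / (((2 * (j : ℕ) + 2) + (2 * (j' : ℕ) + 2) - 1 : ℕ) * (B3o : ℝ) ^ ((2 * (j : ℕ) + 2) + (2 * (j' : ℕ) + 2) - 1)) - 1 / (((2 * (j : ℕ) + 2) + (2 * (j' : ℕ) + 2) - 1 : ℕ) * ((B3o + 1 : ℕ) : ℝ) ^ ((2 * (j : ℕ) + 2)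 + (2 * (j' : ℕ) + 2) - 1))) / 2) * (Bo : ℝ) ^ (2 * (j' : ℕ) + 2) / (Bo : ℝ) ^ (2 * (j : ℕ) + 2)) else 0)) * ((-1 : ℝ) ^ ((k : ℕ) + 1) * (((k : ℕ) : ℝ) + 1) ^ (2 * (j : ℕ) + 1)) * ((-1 : ℝ) ^ ((k' : ℕ) + 1) * (((k' : ℕ) : ℝ) + 1) ^ (2 * (j' : ℕ) + 1)))
          + (1 + θo) * (1 + ηo⁻¹) * (1 / d0o)
            * (∑ r : Fin Jo, ∑ r' : Fin Jo, (((1 / (((2 * (r : ℕ) + 1) + (2 * (r' : ℕ) + 1) - 1 : ℕ) * (B3o : ℝ) ^ ((2 * (r : ℕ) + 1) + (2 * (r' : ℕ) + 1) - 1)) + 1 / (((2 * (r : ℕ) + 1) + (2 * (r' : ℕ) + 1) - 1 : ℕ) * ((B3o + 1 : ℕ) : ℝ) ^ ((2 * (r : ℕ) + 1) + (2 * (r' : ℕ) + 1) - 1))) / 2) + (if r = r' then (∑ r' : Fin Jo, ((1 / (((2 * (r : ℕ) + 1) + (2 * (r' : ℕ) + 1) - 1 : ℕ) * (B3o : ℝ)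 ^ ((2 * (r : ℕ) + 1) + (2 * (r' : ℕ) + 1) - 1)) - 1 / (((2 * (r : ℕ) + 1) + (2 * (r' : ℕ) + 1) - 1 : ℕ) * ((B3o + 1 : ℕ) : ℝ) ^ ((2 * (r : ℕ) + 1) + (2 * (r' : ℕ) + 1) - 1))) / 2) * (Bo : ℝ) ^ (2 * (r' : ℕ) + 1) / (Bo : ℝ) ^ (2 * (r : ℕ) + 1)) else 0)) * ((-1 : ℝ) ^ ((k : ℕ) + 1) * (-((((k : ℕ) : ℝ) + 1) ^ (2 * (r : ℕ))) * ((Complex.digamma (1 / 4 + ((freq a (((k : ℕ) : ℤ) + 1) : ℝ) : ℂ) / 2 * I)).im / 2 + (∑ p ∈ weilPrimeIndex a, (Λ p : ℝ) / Real.sqrt p * Real.sin (freq a (((k : ℕ) : ℤ) + 1) * Real.log p)) - archExpSumSin a (((k : ℕ) : ℤ) + 1)) / π - 4 * (Real.exp (a / 2) - Real.exp (-(a / 2))) ^ 2 / π * (-1 : ℝ) ^ (r : ℕ) * (a ^ 2 / (4 * π ^ 2)) ^ (r : ℕ) * (freq a (((k : ℕ) : ℤ) + 1) / (1 + 4 *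 freq a (((k : ℕ) : ℤ) + 1) ^ 2)))) * ((-1 : ℝ) ^ ((k' : ℕ) + 1) * (-((((k' : ℕ) : ℝ) + 1) ^ (2 * (r' : ℕ))) * ((Complex.digamma (1 / 4 + ((freq a (((k' : ℕ) : ℤ) + 1) : ℝ) : ℂ) / 2 * I)).im / 2 + (∑ p ∈ weilPrimeIndex a, (Λ p : ℝ) / Real.sqrt p * Real.sin (freq a (((k' : ℕ) : ℤ) + 1) * Real.log p)) - archExpSumSin a (((k' : ℕ) : ℤ) + 1)) / π - 4 * (Real.exp (a / 2) - Real.exp (-(a / 2))) ^ 2 / π * (-1 : ℝ) ^ (r' : ℕ) * (a ^ 2 / (4 * π ^ 2)) ^ (r' : ℕ) * (freq a (((k' : ℕ) : ℤ) + 1) / (1 + 4 * freq a (((k' : ℕ) : ℤ) + 1) ^ 2)))))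
          + (if k = k' then (1 + θo⁻¹) * ((Bo : ℝ) / (d0o * ((4 * Jo + 1 : ℕ) * (B3o : ℝ) ^ (4 * Jo + 1)))) * (2 * (π / 4 + (∑ k ∈ weilPrimeIndex a, (Λ k : ℝ) / Real.sqrt k) + a * (1 + weilArchDensity (2 * a)) / π) * (((k : ℕ) : ℝ) + 1) ^ (2 * Jo) / π + 4 * (Real.exp (a / 2) - Real.exp (-(a / 2))) ^ 2 / π * (a ^ 2 / (4 * π ^ 2)) ^ Jo * (freq a (((k : ℕ) : ℤ) + 1) / (1 + 4 * freq a (((k : ℕ) : ℤ) + 1) ^ 2))) ^ 2 else 0)))) :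
    WeilPositivityOn a := by
  have hE0 : 0 < weilArchDensity (2 * a) := weilArchDensity_pos (by positivity)
  have hC : 0 ≤ a * (1 + weilArchDensity (2 * a)) := by positivity
  -- the sector kernels and far diagonals as functions
  set Mev : ℕ → ℕ → ℝ := fun i j ↦ (if i = 0 then gramCoeff a 0 j else if j = 0 then gramCoeff a i 0 else (gramCoeff a i j + gramCoeff a i (-(j : ℤ))) / 2) with hMev
  set Mod : ℕ → ℕ → ℝ := fun k l ↦ ((gramCoeff a ((k : ℤ) + 1) ((l : ℤ) + 1) - gramCoeff a ((k : ℤ) + 1) (-((l : ℤ) + 1))) / 2) with hMod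
  set dev : ℕ → ℝ := fun m ↦ ((reDigammaQuarter (freq a m) - Real.log π) / 2 - a * (1 + weilArchDensity (2 * a)) / (π ^ 2 * m ^ 2) - 1 / (8 * m) - a * (1 + weilArchDensity (2 * a)) / π ^ 2 * Real.sqrt (8 / ((Be - 1 : ℕ) : ℝ)) - (∑ k ∈ weilPrimeIndex a, (Λ k : ℝ) / Real.sqrt k * (2 * Real.cos (π / (⌊2 * a / Real.log k⌋₊ + 2)))) / 2) with hdev
  set dod : ℕ → ℝ := fun l ↦ ((reDigammaQuarter (freq a ((l : ℤ) + 1)) - Real.log π) / 2 - 1 / (8 * ((l : ℝ) + 1)) - a * (1 + weilArchDensity (2 * a)) / (π ^ 2 * ((l : ℝ) + 1) ^ 2) - (π / 2 - Real.arctan (Real.sqrt Bo / Real.sqrt ((l : ℝ) + 1))) / 2 - a * (1 + weilArchDensity (2 * a)) / π ^ 2 * Real.sqrt (8 / Bo) - (∑ k ∈ weilPrimeIndex a, (Λ k : ℝ) / Real.sqrt k * (2 * Real.cos (π / (⌊2 * a / Real.log k⌋₊ + 2)))) / 2 - (Real.exp (a / 2) - Real.exp (-(a / 2))) ^ 2 *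 a / (π ^ 2 * Bo)) with hdod
  refine weilPositivityOn_of_sector_kernels_nonneg ha (gramCoeff a) (weilWindowSesq_chi ha) (gramCoeff_neg_neg a)
    ?_ ?_
  · -- EVEN sector
    intro K y
    have hB3e : 2 ≤ B3e := by omega
    have hB3e1 : 1 ≤ B3e := by omega
    have hd : ∀ m, Be ≤ m → 0 < dev m := fun m hm ↦ by
      simp only [hdev]
      exact even_dhat_pos_of_pos_at ha hBe h0e m hm
    have hdmono : ∀ m, B3e ≤ m → d0e ≤ dev m := fun m hm ↦ by
      simp only [hdev]
      have h := even_dhat_core_mono ha hC hB3e1 hm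
      linarith [hd0e.2]
    have hfar : ∀ (N : ℕ) (y : ℕ → ℝ),
        ∑ n ∈ Finset.Ico Be N, dev n * y n ^ 2 ≤ ∑ n ∈ Finset.Ico Be N, ∑ m ∈ Finset.Ico Be N, y n * Mev n m * y m :=
      fun N y ↦ by
        simp only [hdev, hMev]
        exact gramCoeff_even_far_ge_diag ha hBe N y
    have hU1 : ∀ x : Fin Be → ℝ,
        ∑ m ∈ Finset.Ico Be B3e, (∑ i : Fin Be, Mev i m * x i) ^ 2 / dev m
          ≤ x ⬝ᵥ (Matrix.of fun i j : Fin Be ↦ ∑ m ∈ Finset.Ico Be B3e, Mev i m * Mev j m / we m) *ᵥ x :=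
      fun x ↦ columns_majorant (Finset.Ico Be B3e) (fun m i ↦ Mev i m) dev we
        (fun m hm ↦ by
          have hm := Finset.mem_Ico.mp hm
          have h := hwe m hm.1 hm.2
          simp only [hdev]
          exact h) x
    have hU2 := fun (N : ℕ) (x : Fin Be → ℝ) ↦
      even_tailJ_majorant_matrix ha (by omega : 1 ≤ Be) hBBe hB3e Je dev hd0e.1 hdmono hθe hηe N x
    have key := sum_range_mul_mul_nonneg_of_certificate_sum_split Mev
      (fun n m ↦ evenKernel_symm (gramCoeff a) (gramCoeff_comm a) (gramCoeff_neg_neg a) n m)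
      Be B3e (by omega) dev _ _ hd hfar hU1 (fun N x ↦ by
        have h := hU2 N x
        simp only [hMev, hdev] at h ⊢
        exact h) (fun x ↦ by
        have h := hSe x
        simp only [hMev, Matrix.of_apply] at h ⊢
        exact h) K y
    simpa only [hMev] using key
  · -- ODD sector
    intro K z
    have hB3o : 1 ≤ B3o := by omega
    have hd : ∀ l, Bo ≤ l → 0 < dod l := fun l hl ↦ by
      simp only [hdod]
      exact odd_dhat_atan_pos_of_pos_at ha h0o l hl
    have hdlow : ∀ l, B3o ≤ l → d0o ≤ dod l := fun l hl ↦ by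
      simp only [hdod]
      have h := odd_dhat_core_mono ha hC hl
      have hpen := hilbert_atan_penalty_le Bo l
      linarith [hd0o.2]
    have hfar : ∀ (N : ℕ) (z : ℕ → ℝ),
        ∑ k ∈ Finset.Ico Bo N, dod k * z k ^ 2 ≤ ∑ k ∈ Finset.Ico Bo N, ∑ l ∈ Finset.Ico Bo N, z k * Mod k l * z l :=
      fun N z ↦ by
        simp only [hdod, hMod]
        exact gramCoeff_odd_far_ge_diag_atan ha hBo N z
    have hU1 : ∀ x : Fin Bo → ℝ,
        ∑ l ∈ Finset.Ico Bo B3o, (∑ k : Fin Bo, Mod k l * x k) ^ 2 / dod l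
          ≤ x ⬝ᵥ (Matrix.of fun k k' : Fin Bo ↦ ∑ l ∈ Finset.Ico Bo B3o, Mod k l * Mod k' l / wo l) *ᵥ x :=
      fun x ↦ columns_majorant (Finset.Ico Bo B3o) (fun l k ↦ Mod k l) dod wo
        (fun l hl ↦ by
          have hl := Finset.mem_Ico.mp hl
          have h := hwo l hl.1 hl.2
          simp only [hdod]
          exact h) x
    have hU2 := fun (N : ℕ) (x : Fin Bo → ℝ) ↦
      odd_tailJ_majorant_matrix ha hBo hBBo Jo dod hd0o.1 hdlow hθo hηo N x
    have key := sum_range_mul_mul_nonneg_of_certificate_sum_split Mod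
      (fun k l ↦ oddKernel_symm (gramCoeff a) (gramCoeff_comm a) (gramCoeff_neg_neg a) k l)
      Bo B3o (by omega) dod _ _ hd hfar hU1 (fun N x ↦ by
        have h := hU2 N x
        simp only [hMod, hdod] at h ⊢
        exact h) (fun x ↦ by
        have h := hSo x
        simp only [hMod, Matrix.of_apply] at h ⊢
        exact h) K z
    simpa only [hMod] using key

end Rung

end Summit.RiemannHypothesis.RiemannHypothesis.Theorems.WeilFormatC

end
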